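import Mathlib
import Summits.NavierStokesRegularity.NavierStokesRegularity.Theorems.L3TimeExponentPincerRingDatumLaplacian
import Summits.NavierStokesRegularity.NavierStokesRegularity.Theorems.AxisymmetricExtremalityAxisymmetricKatoGlobalStubSereginLogSwirlOriginCutoffDivCurlPoloidal
import Literature.Analysis.FluidPDE.AxisymSmallSwirlL4
import HarnessLib.Audit
import HarnessLib

/-!
# L3TimeExponentPincer — ring datum calculus VI: the speed of the ring field

Support kernel for the crux `L3CascadeJaw` (item stmt-NavierStokesRegularity-19499): pointwise
size of the ring datum `u₀ = curl (F(|x|²) J)` of `lpPersistence_of_ringData`, from the tree's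
norm identity `‖curl (gJ)‖² = r²(∂₂g)² + (2g + x₀∂₀g + x₁∂₁g)²` (`norm_curl_smul_rotGen_sq`) and
`∂ᵢ(F(|x|²)) = 2xᵢF'(|x|²)` (`fderiv_comp_norm_sq_single`):

* `norm_ringField_sq` — `‖u₀(x)‖² = 4F'(s)² r² x₂² + 4(F(s) + r²F'(s))²` (`s = |x|²`, `r² = x₀² + x₁²`);
* `norm_ringField_sq_le` — `‖u₀(x)‖² ≤ 8(s²F'(s)² + F(s)²)` (energy UPPER bound integrand);
* `norm_ringField_sq_ge` — `4(F(s) + r²F'(s))² ≤ ‖u₀(x)‖²` (energy LOWER bound in the polar cone,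
  where `F + r²F' ≥ κ s^{-3/2}/3` on the dipole zone).

WHAT THIS IS NOT: pure calculus; no fluid statement.
-/

namespace Summit.NavierStokesRegularity.NavierStokesRegularity.Theorems.L3TimeExponentPincerRingDatumVelocity

open Real Literature.Analysis.FluidPDE
open Summit.NavierStokesRegularity.NavierStokesRegularity.Theorems.L3TimeExponentPincerRingDatumLaplacian
open Summit.NavierStokesRegularity.NavierStokesRegularity.Theorems

variable {F : ℝ → ℝ}

/-- **Speed of the ring field**: `‖u₀(x)‖² = 4F'(s)² (x₀² + x₁²) x₂² + 4(F(s) + (x₀² + x₁²)F'(s))²`,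
`s = |x|²`. -/
theorem norm_ringField_sq (hF : Differentiable ℝ F) (x : EuclideanSpace ℝ (Fin 3)) :
    ‖curl (fun y : EuclideanSpace ℝ (Fin 3) => F (‖y‖ ^ 2) • rotGen y) x‖ ^ 2 =
      4 * deriv F (‖x‖ ^ 2) ^ 2 * (x 0 ^ 2 + x 1 ^ 2) * x 2 ^ 2 +
        4 * (F (‖x‖ ^ 2) + (x 0 ^ 2 + x 1 ^ 2) * deriv F (‖x‖ ^ 2)) ^ 2 := by
  have hg : DifferentiableAt ℝ (fun y : EuclideanSpace ℝ (Fin 3) => F (‖y‖ ^ 2)) x :=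
    (hasFDerivAt_comp_norm_sq hF x).differentiableAt
  rw [AxisymmetricKatoGlobal.EulerScaling.norm_curl_smul_rotGen_sq hg,
    fderiv_comp_norm_sq_single hF x 0, fderiv_comp_norm_sq_single hF x 1,
    fderiv_comp_norm_sq_single hF x 2]
  ring

/-- **Energy upper-bound integrand**: `‖u₀(x)‖² ≤ 8((|x|²)² F'(|x|²)² + F(|x|²)²)`. -/
theorem norm_ringField_sq_le (hF : Differentiable ℝ F) (x : EuclideanSpace ℝ (Fin 3)) :
    ‖curl (fun y : EuclideanSpace ℝ (Fin 3) => F (‖y‖ ^ 2) • rotGen y) x‖ ^ 2 ≤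
      8 * ((‖x‖ ^ 2) ^ 2 * deriv F (‖x‖ ^ 2) ^ 2 + F (‖x‖ ^ 2) ^ 2) := by
  have hn : ‖x‖ ^ 2 = x 0 ^ 2 + x 1 ^ 2 + x 2 ^ 2 := by
    rw [EuclideanSpace.norm_sq_eq, Fin.sum_univ_three]
    simp only [Real.norm_eq_abs, sq_abs]
  rw [norm_ringField_sq hF x, hn]
  set a := deriv F (x 0 ^ 2 + x 1 ^ 2 + x 2 ^ 2)
  set f := F (x 0 ^ 2 + x 1 ^ 2 + x 2 ^ 2)
  have hr : 0 ≤ x 0 ^ 2 + x 1 ^ 2 := by positivity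
  have h2 : 0 ≤ x 2 ^ 2 := sq_nonneg _
  set R := x 0 ^ 2 + x 1 ^ 2
  set z := x 2 ^ 2
  have h1 : 4 * (f + R * a) ^ 2 ≤ 8 * f ^ 2 + 8 * R ^ 2 * a ^ 2 := by
    nlinarith [sq_nonneg (f - R * a)]
  have h3 : 4 * a ^ 2 * R * z + 8 * R ^ 2 * a ^ 2 ≤ 8 * ((R + z) ^ 2 * a ^ 2) := by
    nlinarith [mul_nonneg (mul_nonneg hr h2) (sq_nonneg a), mul_nonneg (mul_nonneg h2 h2) (sq_nonneg a)]
  nlinarith [h1, h3]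

/-- **Energy lower-bound integrand**: `4(F(|x|²) + (x₀² + x₁²)F'(|x|²))² ≤ ‖u₀(x)‖²`
(the axial component squared). -/
theorem norm_ringField_sq_ge (hF : Differentiable ℝ F) (x : EuclideanSpace ℝ (Fin 3)) :
    4 * (F (‖x‖ ^ 2) + (x 0 ^ 2 + x 1 ^ 2) * deriv F (‖x‖ ^ 2)) ^ 2 ≤
      ‖curl (fun y : EuclideanSpace ℝ (Fin 3) => F (‖y‖ ^ 2) • rotGen y) x‖ ^ 2 := by
  rw [norm_ringField_sq hF x]
  nlinarith [mul_nonneg (mul_nonneg (sq_nonneg (deriv F (‖x‖ ^ 2))) (add_nonneg (sq_nonneg (x 0)) (sq_nonneg (x 1))))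
    (sq_nonneg (x 2))]

/-- **Polar-cone lower bound for the axial factor**: if `F'(s) = −κ s^{-5/2}`,
`F(s) ≥ (2κ/3)(s^{-3/2} − b^{-3/2})`, `0 ≤ κ`, `0 < s`, the point lies in the polar cone
`ρ = x₀² + x₁² ≤ s/4` and `b^{-3/2} ≤ s^{-3/2}/8`, then `F(s) + (x₀² + x₁²)F'(s) ≥ κ s^{-3/2}/3`. -/
theorem axial_factor_ge {κ s b ρ Fs F's : ℝ} (hκ : 0 ≤ κ) (hs : 0 < s)
    (hF' : F's = -κ * s ^ (-(5 / 2 : ℝ))) (hFs : (2 * κ / 3) * (s ^ (-(3 / 2 : ℝ)) - b ^ (-(3 / 2 : ℝ))) ≤ Fs)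
    (hcone : ρ ≤ s / 4) (hb : b ^ (-(3 / 2 : ℝ)) ≤ s ^ (-(3 / 2 : ℝ)) / 8) :
    κ * s ^ (-(3 / 2 : ℝ)) / 3 ≤ Fs + ρ * F's := by
  have e2 : s * s ^ (-(5 / 2 : ℝ)) = s ^ (-(3 / 2 : ℝ)) := by
    rw [show (-(3 / 2 : ℝ)) = -(5 / 2 : ℝ) + 1 by norm_num, Real.rpow_add_one hs.ne']
    ring
  have h5 : 0 ≤ s ^ (-(5 / 2 : ℝ)) := Real.rpow_nonneg hs.le _
  -- ρ F' ≥ −(s/4) κ s^{-5/2} = −κ s^{-3/2}/4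
  have h1 : -(κ * s ^ (-(3 / 2 : ℝ)) / 4) ≤ ρ * F's := by
    rw [hF', ← e2]
    nlinarith [mul_nonneg hκ h5, mul_le_mul_of_nonneg_right hcone (mul_nonneg hκ h5)]
  nlinarith [mul_nonneg hκ (Real.rpow_nonneg hs.le (-(3 / 2 : ℝ)))]

end Summit.NavierStokesRegularity.NavierStokesRegularity.Theorems.L3TimeExponentPincerRingDatumVelocity
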